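import Literature.NumberTheory.EllipticCurves.HeegnerPointsOfConductor
import Literature.NumberTheory.EllipticCurves.HeegnerPointsImaginaryQuadraticProofs
import Literature.NumberTheory.QuadraticFields.FundamentalDiscriminant
import HarnessLib

/-!
# Voight 2007 (Math. Comp. 76), §3 Prop. 3.8: which quadratic fields `ℚ(√m)` lie in the ring class
# field of modulus `f` of an imaginary quadratic field — the GENUS CLASS FIELD of the order of
# discriminant `D = d f²`, AS PRINTED; with the proved consumer corollaries «`√d ∈ K[|d|]`» and
# «`√d ∉ K[|d|/ℓ]`» (the genus field of track U2 of the cell `bsd-uniform`)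

Source: J. Voight, *Quadratic forms that represent almost the same primes*, Math. Comp. **76**
(2007), no. 259, 1589–1617, doi:10.1090/S0025-5718-07-01976-X [Voight2007] (PUBLISHED; held text =
the author's arXiv version `math/0410266`, key `paper:arxiv-math_0410266`, locators `pNNNN Lk` =
its materialised 3000-character chunks; theorem numbering of that version). ONE named fact
(`def … : Prop`, D-0014, nothing asserted) typing Prop. 3.8 (with Prop. 3.1 and Prop. 3.7, which say
what "`⊂ P_(f)`" means inside the ring class field) in the vocabulary of the tree's CONCRETE ring
class field `ringClassField K ι f ⊂ ℂ` (`HeegnerPointsOfConductor.lean`: the field generated over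
`ι(K)` by the singular moduli of discriminant `f² d_K`; that this IS the ring class field of
conductor `f` — Cox, Thm. 11.1 — is PROVED in the tree: `exists_classField_algEquiv_ringClassField`,
`mem_splitPrimes_ringClassField_iff`, `isUnramifiedIn_ringClassField`,
`finrank_ringClassField_eq_classNumber` in `RingClassFieldClassNumber.lean` /
`RingClassFieldSplitting.lean`), followed by PROVED corollaries in exactly the binder shape of the
consumer `Summit.BirchSwinnertonDyer.Uniform.U2.bsdp_two_genusPair_rankOne_noFlip_of_genusField`
(`Summits/BirchSwinnertonDyer/Uniform/U2/GenusFieldEndToEnd.lean`, binders `r₀`, `hsq`, `hgen`) and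
of `GenusCharacter.exists_monoidHom_cutout` / `isRationalCharacterFor_of_cutout` /
`isPrimitiveOfConductor_of_cutout` (`…/U2/GenusCharacter.lean`), which turn «`√d ∈ K[|d|]`,
`√d ∉ K[|d|/ℓ]`» into the genus character `χ_d` of `Gal(K[|d|]/K)`, primitive of conductor `|d|`,
with `Gross2004.IsRationalCharacterFor χ_gal d` (RESIDUE.md R2-10 (a), referee V4 F-A3: the
«`K(√M*) ⊂ H_M`, `χ_M` primitive» step, here shown to be IN PRINT and typed as printed).

HONEST FRAMING (cell `bsd-uniform`, HOME run/shared/lean/pub/bsd-uniform/, seat u2-lit, literature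
typer): a PUBLISHED statement vendored as a named `Prop`, every printed standing hypothesis a
binder, locators into the held text; nothing asserted, nothing booked, no census number moved. What
this is NOT: not a proof of Prop. 3.8 (class field theory of `K[f]`: the conductor–discriminant
formula for `ℚ(√m)K/K`; a discharge from the tree's proved class field theory of `K[f]` — Bauer's
theorem `le_of_splitPrimes_subset_algClosure`, the splitting law `mem_splitPrimes_ringClassField_iff`,
the decomposition law of `QuadraticExtensionPlaces.lean` — is recorded as the preferred route in the
seat's NOTES), not a statement about Heegner points or `L`-functions.

## The printed statements (verbatim)

§3, standing notation [p0006 L5]: "Let `K = ℚ(√d)` be an imaginary quadratic field of discriminant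
`d < 0` with ring of integers `A`. For an integer `f ≥ 1`, consider the order `A_f = ℤ + fA`; the
discriminant of `A_f` is `D = df²`. … Let `Cl_f(d) = Cl(D) = Pic(A_f)` be the class group of the
order `A_f` … Given an ideal `𝔞 ⊂ A` prime to `f`, the `A_f`-module `𝔞 ∩ A_f` is trivial in `Cl(D)`
if and only if `𝔞` is principal and generated by an element `α` with `α ≡ z (mod fA)` for some
`z ∈ ℤ`."

Prop. 3.1 ([Cox]) [p0006 L7–L33]: "There is a unique field `R_(f) ⊃ K` inside `K̄` that is abelian
over `K` with the following properties: • Each prime `𝔭` of `K` coprime to `f` is unramified in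
`R_(f)`; • There is an isomorphism `Cl_f(d) ≅ Gal(R_(f)/K)`, `[𝔭 ∩ A_f] ↦ Frob_𝔭` for each prime
`𝔭` of `K` coprime to `f`. The field `R_(f)` is the largest abelian extension of `K` of conductor
dividing `(f)` in which all but finitely many primes of `K` inert over `ℚ` split completely. … The
field `R_(f)` is called the ring class field of `K` of modulus `f`, and the map
`Cl_f(d) ≅ Gal(R_(f)/K)` is known as the Artin map."

Prop. 3.7 [p0006 L58–L69]: "The field `P_(f) ⊂ R_(f)` given by `Gal(P_(f)/K) ≅ Cl_f(d)/Cl_f(d)²`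
is the largest subextension of `R_(f) ⊃ K` with Galois group `Gal(R_(f)/K)` of exponent dividing
`2`. Moreover, the Galois group `Gal(P_(f)/ℚ)` is itself abelian and of exponent `2`. The field
`P_(f)` is called the genus class field of `K` of modulus `f`."

Prop. 3.8 [p0006 L71–L72] — THE TYPED STATEMENT: "The genus class field `P_(f)` of `K` is the
compositum of all fields `K = ℚ(√m)` [sic; `H = ℚ(√m)` in the proof] of discriminant `m ∈ ℤ`
satisfying `m · disc(ℚ(√(dm))) ∣ D`." Proof [p0006 L74–L82]: "By Proposition 3.7, the group
`Gal(P_(f)/ℚ)` is abelian and of exponent `2`, so by Kummer theory it is the compositum of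
quadratic extensions of `ℚ`. Let `H = ℚ(√m)` be a quadratic field of discriminant `m ∈ ℤ`. Note
that automatically every prime of `K` which is inert over `ℚ` and unramified in `HK/K` splits
completely in `HK`; therefore `H ⊂ P_(f)` if and only if the conductor `𝔣` of the extension `HK/K`
satisfies `𝔣 ∣ fA`. … By the conductor-discriminant formula [Washington], the conductor of the
extension `HK/K` is equal to `disc(HK/K)`, and moreover `disc(HK/ℚ) = dmn`, where
`n = disc(ℚ(√(dm)))`. … we conclude that `𝔣² = (mn/d)ℤ`, and so `𝔣 ∣ f` if and only if
`mn ∣ df² = D`, as claimed."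

Cor. 3.9 [p0007 L1–L15] ("For `p` an odd prime we write `p* = (−1)^{(p−1)/2} p`" [p0006 L84]):
"Let `p₁, …, p_r` be the odd primes dividing `D` and let `K* = K(√p₁*, …, √p_r*)`. Then the genus
class field `P_(f)` of `K` is as follows: `P_(f) = K*(√−1)` if `d ≡ 1 (mod 4)` and `4 ∥ f`;
`K*(√−1, √2)` if `d ≡ 1 (mod 4)` and `8 ∣ f`; `K*(√2)` if `d ≡ 4 (mod 8)` and `4 ∣ f`; `K*(√−1)` if
`d ≡ 0 (mod 8)` and `2 ∣ f`; `K*` otherwise." Cor. 3.10 [p0007 L43–L44]: "The odd primes `p` which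
ramify in `P_(f)` are exactly the odd primes that divide `D`."

## Transcription (tree vocabulary; nothing re-declared)

* `K`, `d`, `f`, `D = d f²`: `K : Type` with `IsImaginaryQuadratic K` (so `d = NumberField.discr K
  < 0` is a fundamental discriminant — tree `isFundamentalDiscriminant_discr`), `f : ℕ`, `f ≠ 0`.
* `R_(f)`: the tree's `ringClassField K ι f ⊂ ℂ` (`ι : K →+* ℂ`). Justification that this is
  Voight's `R_(f)` up to `K`-isomorphism (so that "`√m ∈ R_(f)`" transcribes as
  "`∃ r : ringClassField K ι f, r² = m`"): Prop. 3.1 characterises `R_(f)` as the UNIQUE abelian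
  extension of `K` unramified at the primes coprime to `f` whose Artin map identifies
  `Gal(R_(f)/K)` with `Cl_f(d)`, i.e. (quoted standing notation) in which a prime `𝔭 ∤ f` splits
  completely iff `𝔭 = αA` with `α ≡ z (mod fA)`, `z ∈ ℤ`; the tree PROVES exactly this for
  `ringClassField K ι f` (`mem_splitPrimes_ringClassField_iff`: `v ∤ f` splits completely iff
  `primeClass f v = 1` in `I_K(f)/P_{K,ℤ}(f)`; `isUnramifiedIn_ringClassField`;
  `exists_classField_algEquiv_ringClassField`: a `K`-isomorphism with the class field `R ⊆ K̄`
  carrying this splitting law — Cox, Thm. 11.1), and a field extension of a number field is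
  determined by its set of completely split primes (Bauer; tree `le_of_splitPrimes_subset_algClosure`).
* "`H = ℚ(√m)` a quadratic field of discriminant `m`": `m` a fundamental discriminant, spelled as in
  the tree's `QuadraticFields/FundamentalDiscriminant.lean` (`m ≡ 1 (mod 4)` squarefree `≠ 1`, or
  `m = 4m'` with `m' ≡ 2, 3 (mod 4)` squarefree); "`H ⊂ P_(f)`" ⟺ "`√m ∈ R_(f)`": (⟸) `K(√m)/K` is
  a subextension of `R_(f)/K` with Galois group of exponent dividing `2`, hence inside `P_(f)` by
  the maximality clause of Prop. 3.7; (⟹) `P_(f) ⊂ R_(f)` (Prop. 3.7).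
* "`n = disc(ℚ(√(dm)))`": the integer `n` with `d·m = n·s²` for some `s ∈ ℤ` which is a
  fundamental discriminant — or `n = 1` when `dm` is a square (`m = d`, `ℚ(√(dm)) = ℚ`); `n` is
  unique (tree `eq_of_isFundamental_of_eq_mul_sq`), so it enters as data `(n, s)` with these two
  hypotheses.
* "`m · n ∣ D`": `m * n ∣ NumberField.discr K * f²` in `ℤ`.

For the cell's genus field (track U2: `d ≡ 1 (mod 4)` squarefree, `d ≠ 1`, coprime to `d_K`,
`M = |d|`, so `d = M* = ∏_{p ∣ M} p*`): `m = d`, `n = d_K · d` (a fundamental discriminant, proved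
below: `isFundamental_mul_of_odd`), `s = 1`, and the printed criterion reads `d_K d² ∣ d_K f²`, i.e.
`|d| ∣ f`: TRUE at `f = |d|` («`√d ∈ K[|d|]`», Cor. 3.9's `K* ⊂ P_(f) ⊂ R_(f)`) and FALSE at
`f = |d|/ℓ` for a prime `ℓ ∣ d` («`√d ∉ K[|d|/ℓ]`», Cor. 3.10) — the corollaries
`prop38_sqrt_mem_ringClassField_iff.exists_sq_eq`, `.natAbs_dvd_of_sq_eq`,
`.not_mem_ringClassField_div`, `.genusField` below.

Mathlib/tree search (2026-08-26): `genus`, `ringClassField`, `sqrt … mem`, `P_(f)` — the tree has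
the CONCRETE `ringClassField` with its class field theory proved (files listed above), genus
characters of `Cl(𝓞_K)` for the MAXIMAL order only (`QuadraticFields/GenusCharacters.lean`,
unramified), and no statement placing `√m` in a ring class field of conductor `f > 1`; the consumer
side (`…/U2/GenusCharacter.lean`, p451117) was written against the binders discharged here.
Other printed sources for the same classical fact (genus theory of ring class fields): F. Halter-Koch,
*Geschlechtertheorie der Ringklassenkörper*, J. reine angew. Math. 250 (1971) 107–108 (not held;
acquisition acq-10595); D. A. Cox, *Primes of the form x² + ny²*, Thm. 9.18 and Exercises 9.20–9.23
(ring class fields ⟺ generalized dihedral; the conductor `𝔣(L/K) = f𝒪_K`), which Voight cites as [Cox].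
-- TODO(general form): Voight's §3 also covers the 2-power part of `P_(f)` (Cor. 3.9's four dyadic
-- cases) through the same criterion; no consumer needs `m` even, but the typed criterion allows it.

## References

* [Voight2007] J. Voight, *Quadratic forms that represent almost the same primes*, Math. Comp. 76
  (2007), 1589–1617: §3, Prop. 3.1, Prop. 3.7, Prop. 3.8 (the typed statement), Cor. 3.9–3.10.
* [Cox2013] D. A. Cox, *Primes of the form x² + ny²*, 2nd ed. (2013): §9.A (ring class fields),
  Thm. 9.18, Exercises 9.20–9.23, Thm. 11.1 (`K(j(𝒪)) =` the ring class field; tree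
  `RingClassFieldClassNumber.lean`).
* F. Halter-Koch, *Geschlechtertheorie der Ringklassenkörper*, J. reine angew. Math. 250 (1971),
  107–108 (the classical reference; not held).
-/

noncomputable section

open scoped Classical

open NumberField Literature.NumberTheory.QuadraticFields.Quadratic

namespace Literature.NumberTheory.EllipticCurves

namespace Voight2007

/-! ### An elementary lemma on fundamental discriminants (used to name `n = disc ℚ(√(d_K d))`) -/

/-- **The product of two coprime fundamental discriminants, one of them odd, is a fundamental
discriminant** (so for `d ≡ 1 (mod 4)` squarefree, `d ≠ 1`, coprime to `d_K`, the field
`ℚ(√(d_K d))` has discriminant `d_K d`). Fundamental discriminants are spelled out as in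
`QuadraticFields/FundamentalDiscriminant.lean`. [folklore] -/
private theorem isFundamental_mul_of_odd {D d : ℤ}
    (hD : (D % 4 = 1 ∧ Squarefree D ∧ D ≠ 1) ∨
      (4 ∣ D ∧ (D / 4 % 4 = 2 ∨ D / 4 % 4 = 3) ∧ Squarefree (D / 4)))
    (hd4 : d % 4 = 1) (hd : Squarefree d) (hd1 : d ≠ 1) (hcop : IsCoprime D d) :
    ((D * d) % 4 = 1 ∧ Squarefree (D * d) ∧ D * d ≠ 1) ∨
      (4 ∣ D * d ∧ (D * d / 4 % 4 = 2 ∨ D * d / 4 % 4 = 3) ∧ Squarefree (D * d / 4)) := by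
  rcases hD with ⟨hD4, hDsq, -⟩ | ⟨⟨e, rfl⟩, he4, hesq⟩
  · refine Or.inl ⟨?_, squarefree_mul_iff.mpr ⟨hcop.isRelPrime, hDsq, hd⟩, ?_⟩
    · rw [Int.mul_emod, hD4, hd4]; norm_num
    · intro h
      have hdvd : d ∣ 1 := ⟨D, by rw [mul_comm]; exact h.symm⟩
      rcases Int.isUnit_iff.mp (isUnit_of_dvd_one hdvd) with h1 | h1
      · exact hd1 h1
      · rw [h1] at hd4; norm_num at hd4
  · rw [Int.mul_ediv_cancel_left _ four_ne_zero] at he4 hesq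
    have hcop' : IsCoprime e d := IsCoprime.of_mul_left_right hcop
    have hediv : 4 * e * d / 4 = e * d := by rw [mul_assoc, Int.mul_ediv_cancel_left _ four_ne_zero]
    refine Or.inr ⟨⟨e * d, by ring⟩, ?_, ?_⟩
    · rw [hediv, Int.mul_emod, hd4]
      rcases he4 with h | h <;> rw [h] <;> norm_num
    · rw [hediv]
      exact squarefree_mul_iff.mpr ⟨hcop'.isRelPrime, hesq, hd⟩

/-- If `d · d'` is squarefree then `d` and `d'` are coprime (the consumer
`bsdp_two_genusPair_rankOne_noFlip_of_genusField` carries `Squarefree (d * d_K)`). [folklore] -/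
private theorem isCoprime_of_squarefree_mul {d d' : ℤ} (h : Squarefree (d * d')) : IsCoprime d d' :=
  (squarefree_mul_iff.mp h).1.isCoprime

/-! ### Prop. 3.8 (with Prop. 3.1, Prop. 3.7): square roots of discriminants in `R_(f)`, as a named fact -/

/-- **Voight 2007, Prop. 3.8 (with Prop. 3.1 and Prop. 3.7) — the genus class field of modulus `f`:
a quadratic field `ℚ(√m)` of discriminant `m` lies in the ring class field `R_(f)` of the imaginary
quadratic field `K` of discriminant `d` (equivalently, by Prop. 3.7, in its genus class field
`P_(f)`, the largest subextension of `R_(f)/K` of exponent `2`) if and only if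
`m · disc(ℚ(√(dm))) ∣ D = d f²`** (verbatim in the module docstring, with the proof's sentence
"`H ⊂ P_(f)` if and only if the conductor `𝔣` of `HK/K` satisfies `𝔣 ∣ fA` … if and only if
`mn ∣ df² = D`"). Typed for the tree's `R_(f) = ringClassField K ι f ⊂ ℂ` (Cox Thm. 11.1, proved in
the tree): for `K` imaginary quadratic (`d = NumberField.discr K`), `ι : K →+* ℂ`, `f ≥ 1`, a
fundamental discriminant `m`, and `n = disc(ℚ(√(dm)))` entered as the fundamental discriminant (or
`1`, when `dm` is a square) with `d m = n s²`:
`(∃ r ∈ K[f], r² = m) ↔ m n ∣ d f²`. Named fact (PUBLISHED); nothing asserted; users take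
`(h : prop38_sqrt_mem_ringClassField_iff)`; the genus-field corollaries «`√d ∈ K[|d|]`»,
«`√d ∉ K[|d|/ℓ]`» are proved from it below.
[cite: Voight2007, §3 Prop. 3.8 (with Prop. 3.1 "R_(f) … ring class field of modulus f", Prop. 3.7 "P_(f) ⊂ R_(f) … largest subextension … of exponent dividing 2", Cor. 3.9–3.10)] -/
def prop38_sqrt_mem_ringClassField_iff : Prop :=
  ∀ (K : Type) [Field K] [NumberField K], IsImaginaryQuadratic K → ∀ (ι : K →+* ℂ) (f : ℕ), f ≠ 0 →
    ∀ (m n s : ℤ),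
      ((m % 4 = 1 ∧ Squarefree m ∧ m ≠ 1) ∨
        (4 ∣ m ∧ (m / 4 % 4 = 2 ∨ m / 4 % 4 = 3) ∧ Squarefree (m / 4))) →
      (((n % 4 = 1 ∧ Squarefree n ∧ n ≠ 1) ∨
        (4 ∣ n ∧ (n / 4 % 4 = 2 ∨ n / 4 % 4 = 3) ∧ Squarefree (n / 4))) ∨ n = 1) →
      NumberField.discr K * m = n * s ^ 2 →
      ((∃ r : ringClassField K ι f, r ^ 2 = (m : ringClassField K ι f)) ↔
        m * n ∣ NumberField.discr K * (f : ℤ) ^ 2)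

/-! ### Proved consumer corollaries: the genus field «`√d ∈ K[|d|]`, `√d ∉ K[|d|/ℓ]`» -/

/-- **«`√d ∈ K[|d|]`» (Cor. 3.9: `K* = K(√p₁*, …, √p_r*) ⊂ P_(f) ⊂ R_(f)`, here for
`d = ∏_{p ∣ d} p*`):** for `K` imaginary quadratic and `d ≡ 1 (mod 4)` squarefree, `d ≠ 1`, coprime
to `d_K`, the ring class field `K[|d|]` contains a square root of `d`. From Prop. 3.8 with `m = d`,
`n = d_K d` (fundamental, `isFundamental_mul_of_odd`), `s = 1`, `f = |d|`: the criterion reads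
`d_K d² ∣ d_K |d|²`. This is the binder `r₀, hsq` of
`Summit.BirchSwinnertonDyer.Uniform.U2.bsdp_two_genusPair_rankOne_noFlip_of_genusField`.
[cite: Voight2007, §3 Prop. 3.8 and Cor. 3.9 (corollary)] -/
theorem prop38_sqrt_mem_ringClassField_iff.exists_sq_eq (h : prop38_sqrt_mem_ringClassField_iff)
    (K : Type) [Field K] [NumberField K] (hK : IsImaginaryQuadratic K) (ι : K →+* ℂ)
    {d : ℤ} (hd4 : d % 4 = 1) (hd : Squarefree d) (hd1 : d ≠ 1)
    (hcop : IsCoprime d (NumberField.discr K)) :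
    ∃ r : ringClassField K ι d.natAbs, r ^ 2 = (d : ringClassField K ι d.natAbs) := by
  have hd0 : d ≠ 0 := by rintro rfl; norm_num at hd4
  have hf : d.natAbs ≠ 0 := Int.natAbs_ne_zero.mpr hd0
  have hfund := isFundamental_mul_of_odd
    (isFundamentalDiscriminant_discr (K := K) hK.finrank_eq_two) hd4 hd hd1 hcop.symm
  refine (h K hK ι d.natAbs hf d (NumberField.discr K * d) 1 (Or.inl ⟨hd4, hd, hd1⟩)
    (Or.inl hfund) (by ring)).mpr ?_
  rw [Int.natCast_natAbs, sq_abs]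
  exact ⟨1, by ring⟩

/-- **Prop. 3.8, (⟹) for the odd genus discriminant `d`:** if `K[f]` contains a square root of `d`
(`d ≡ 1 (mod 4)` squarefree, `d ≠ 1`, coprime to `d_K`), then `|d| ∣ f` — the printed criterion
`m n = d_K d² ∣ d_K f²` with `d_K ≠ 0`. [cite: Voight2007, §3 Prop. 3.8 (corollary)] -/
theorem prop38_sqrt_mem_ringClassField_iff.natAbs_dvd_of_sq_eq
    (h : prop38_sqrt_mem_ringClassField_iff)
    (K : Type) [Field K] [NumberField K] (hK : IsImaginaryQuadratic K) (ι : K →+* ℂ)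
    {d : ℤ} (hd4 : d % 4 = 1) (hd : Squarefree d) (hd1 : d ≠ 1)
    (hcop : IsCoprime d (NumberField.discr K)) {f : ℕ} (hf : f ≠ 0)
    (r : ringClassField K ι f) (hr : r ^ 2 = (d : ringClassField K ι f)) : d.natAbs ∣ f := by
  have hfund := isFundamental_mul_of_odd
    (isFundamentalDiscriminant_discr (K := K) hK.finrank_eq_two) hd4 hd hd1 hcop.symm
  have hdvd := (h K hK ι f hf d (NumberField.discr K * d) 1 (Or.inl ⟨hd4, hd, hd1⟩)
    (Or.inl hfund) (by ring)).mp ⟨r, hr⟩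
  have hD0 : NumberField.discr K ≠ 0 := NumberField.discr_ne_zero K
  have h2 : d ^ 2 ∣ (f : ℤ) ^ 2 := by
    have h' : NumberField.discr K * d ^ 2 ∣ NumberField.discr K * (f : ℤ) ^ 2 := by
      have e : d * (NumberField.discr K * d) = NumberField.discr K * d ^ 2 := by ring
      rwa [e] at hdvd
    exact (mul_dvd_mul_iff_left hD0).mp h'
  have h3 : d.natAbs ^ 2 ∣ f ^ 2 := by
    simpa [Int.natAbs_pow] using Int.natAbs_dvd_natAbs.mpr h2
  exact (Nat.pow_dvd_pow_iff two_ne_zero).mp h3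

/-- **«`√d ∉ K[|d|/ℓ]` for every prime `ℓ ∣ d`» (Cor. 3.10: the odd primes ramified in `P_(f)` are
exactly the odd primes dividing `D = d_K f²`; here from Prop. 3.8's criterion, which at `f = |d|/ℓ`
would force `|d| ∣ |d|/ℓ`):** no square root of `d` in `ℂ` lies in `K[|d|/ℓ]`. This is the binder
`hgen` of `Summit.BirchSwinnertonDyer.Uniform.U2.bsdp_two_genusPair_rankOne_noFlip_of_genusField`
and of `GenusCharacter.isPrimitiveOfConductor_of_cutout` (primitivity of the genus character
`χ_d` of conductor `|d|`). [cite: Voight2007, §3 Prop. 3.8 and Cor. 3.10 (corollary)] -/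
theorem prop38_sqrt_mem_ringClassField_iff.not_mem_ringClassField_div
    (h : prop38_sqrt_mem_ringClassField_iff)
    (K : Type) [Field K] [NumberField K] (hK : IsImaginaryQuadratic K) (ι : K →+* ℂ)
    {d : ℤ} (hd4 : d % 4 = 1) (hd : Squarefree d) (hd1 : d ≠ 1)
    (hcop : IsCoprime d (NumberField.discr K)) {ℓ : ℕ} (hℓ : ℓ ∈ d.natAbs.primeFactors)
    {r : ℂ} (hr : r ^ 2 = (d : ℂ)) : r ∉ ringClassField K ι (d.natAbs / ℓ) := by
  intro hmem
  have hd0 : d ≠ 0 := by rintro rfl; norm_num at hd4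
  have hd0' : 0 < d.natAbs := Int.natAbs_pos.mpr hd0
  have hℓp : ℓ.Prime := Nat.prime_of_mem_primeFactors hℓ
  have hℓd : ℓ ∣ d.natAbs := Nat.dvd_of_mem_primeFactors hℓ
  have hfpos : 0 < d.natAbs / ℓ := Nat.div_pos (Nat.le_of_dvd hd0' hℓd) hℓp.pos
  set r' : ringClassField K ι (d.natAbs / ℓ) := ⟨r, hmem⟩ with hr'def
  have hr' : r' ^ 2 = (d : ringClassField K ι (d.natAbs / ℓ)) := by
    apply Subtype.ext
    simp [hr'def, hr]
  have hdvd := h.natAbs_dvd_of_sq_eq K hK ι hd4 hd hd1 hcop hfpos.ne' r' hr'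
  exact absurd (Nat.le_of_dvd hfpos hdvd) (not_le.mpr (Nat.div_lt_self hd0' hℓp.one_lt))

/-- The same for a square root `r₀ ∈ K[|d|]` read in `ℂ` (the exact shape of the consumer's binder
`hgen`). [cite: Voight2007, §3 Prop. 3.8 and Cor. 3.10 (corollary)] -/
theorem prop38_sqrt_mem_ringClassField_iff.coe_not_mem_ringClassField_div
    (h : prop38_sqrt_mem_ringClassField_iff)
    (K : Type) [Field K] [NumberField K] (hK : IsImaginaryQuadratic K) (ι : K →+* ℂ)
    {d : ℤ} (hd4 : d % 4 = 1) (hd : Squarefree d) (hd1 : d ≠ 1)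
    (hcop : IsCoprime d (NumberField.discr K))
    (r₀ : ringClassField K ι d.natAbs) (hsq : r₀ ^ 2 = (d : ringClassField K ι d.natAbs))
    {ℓ : ℕ} (hℓ : ℓ ∈ d.natAbs.primeFactors) : (r₀ : ℂ) ∉ ringClassField K ι (d.natAbs / ℓ) := by
  refine h.not_mem_ringClassField_div K hK ι hd4 hd hd1 hcop hℓ ?_
  have := congrArg Subtype.val hsq
  simpa using this

/-- **The genus field of track U2, in one statement:** for `K` imaginary quadratic and
`d ≡ 1 (mod 4)` squarefree, `d ≠ 1`, coprime to `d_K`, there is `r₀ ∈ K[|d|]` with `r₀² = d`, and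
no such square root lies in `K[|d|/ℓ]` for a prime `ℓ ∣ d` — literally the binders `r₀`, `hsq`,
`hgen` of `Summit.BirchSwinnertonDyer.Uniform.U2.bsdp_two_genusPair_rankOne_noFlip_of_genusField`,
so that (with `GenusCharacter.exists_monoidHom_cutout`, `isRationalCharacterFor_of_cutout`,
`isPrimitiveOfConductor_of_cutout`) the genus character `χ_d` of `Gal(K[|d|]/K)` exists, is
primitive of conductor `|d|`, and satisfies `Gross2004.IsRationalCharacterFor χ_gal d`.
[cite: Voight2007, §3 Prop. 3.8 with Cor. 3.9–3.10 (corollary)] -/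
theorem prop38_sqrt_mem_ringClassField_iff.genusField (h : prop38_sqrt_mem_ringClassField_iff)
    (K : Type) [Field K] [NumberField K] (hK : IsImaginaryQuadratic K) (ι : K →+* ℂ)
    {d : ℤ} (hd4 : d % 4 = 1) (hd : Squarefree d) (hd1 : d ≠ 1)
    (hcop : IsCoprime d (NumberField.discr K)) :
    ∃ r₀ : ringClassField K ι d.natAbs, r₀ ^ 2 = (d : ringClassField K ι d.natAbs) ∧
      ∀ ℓ ∈ d.natAbs.primeFactors, (r₀ : ℂ) ∉ ringClassField K ι (d.natAbs / ℓ) := by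
  obtain ⟨r₀, hsq⟩ := h.exists_sq_eq K hK ι hd4 hd hd1 hcop
  exact ⟨r₀, hsq, fun ℓ hℓ => h.coe_not_mem_ringClassField_div K hK ι hd4 hd hd1 hcop r₀ hsq hℓ⟩

/-- Variant with the consumer's hypothesis `Squarefree (d * d_K)` in place of coprimality.
[cite: Voight2007, §3 Prop. 3.8 with Cor. 3.9–3.10 (corollary)] -/
theorem prop38_sqrt_mem_ringClassField_iff.genusField_of_squarefree_mul
    (h : prop38_sqrt_mem_ringClassField_iff)
    (K : Type) [Field K] [NumberField K] (hK : IsImaginaryQuadratic K) (ι : K →+* ℂ)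
    {d : ℤ} (hd4 : d % 4 = 1) (hd1 : d ≠ 1) (hsqf : Squarefree (d * NumberField.discr K)) :
    ∃ r₀ : ringClassField K ι d.natAbs, r₀ ^ 2 = (d : ringClassField K ι d.natAbs) ∧
      ∀ ℓ ∈ d.natAbs.primeFactors, (r₀ : ℂ) ∉ ringClassField K ι (d.natAbs / ℓ) :=
  h.genusField K hK ι hd4 hsqf.of_mul_left hd1 (isCoprime_of_squarefree_mul hsqf)

end Voight2007

end Literature.NumberTheory.EllipticCurves

end
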